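import Mathlib
import Literature.MathematicalPhysics.QuantumLattice.SU2Haar
import Literature.MathematicalPhysics.QuantumFieldTheory.Balaban1983to89.UnitaryModel
import Literature.MathematicalPhysics.QuantumFieldTheory.Balaban1983to89.T4QuatExpLog

/-!
# The chord contraction of a bondwise-small `SU(2)` lattice gauge field stays in its plaquette window
# (toolkit for the stub `stub_gaugeSmallChains` of `BackwardLiouvilleRigidity.FlatRatioTermination`, stmt-QuantumFields-22542)

In the tree's quaternion model of `SU(2)` (`quatMatrix`, `su2Quat`, `quatToSU2` of `SU2Haar`; `dist1 = ‖· − 1‖_op` of `UnitaryModel`):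
* §1 `quatMatrix_star`, `dist1_eq_norm_sub_one_of_coe_eq` (with the tree's isometry `T4QuatExpLog.norm_quatMatrix_sub_one`).
* §2 `norm_prod_one_add_sub_le`: the MAJORANT `‖Π(1 + xᵢ) − 1 − Σxᵢ‖ ≤ (1+η)^n − 1 − nη` in any normed ring.
* §3 `normSq_one_add_smul`, `norm_one_add_smul_bounds`: along the CHORD `1 + t b` of a unit quaternion `1 + b`, `‖b‖ ≤ η`,
  `1 − η²/4 ≤ ‖1 + t b‖ ≤ 1`.
* §4 `norm_chordProd_sub_one_le`: the product of four normalised chords is within `‖Π(1 + bᵢ) − 1‖ + 16η²` of `1` (`η ≤ 1/4`).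
* §A on the lattice: `dist1_plaqHol_quatToSU2` (plaquette variables of a configuration `e ↦ quatToSU2 (x e)` in the model),
  ★ `dist1_plaqHol_chord_le`: the chord contraction `C_t e = quatToSU2 (1 + t (su2Quat (A e) − 1))` of a bondwise `η`-small `A` has every
  plaquette variable within `16η²` of `A`'s, and ★ `dist1_chordStep_le`: `C_{t'} e · (C_t e)⁻¹` is within `|t' − t| η + η²/2` of `1`.

HONEST SCOPE.  Helper lemmas `--supports stmt-QuantumFields-22542`; elementary quaternion/matrix analysis, nothing about the global-gauge stub, the crux,
rung R3 or any summit statement; nothing here bears on the Yang–Mills mass gap.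
-/

namespace Summit.QuantumFields.YangMills.Theorems.FlatRatioTermination

open Quaternion
open Literature.MathematicalPhysics.QuantumLattice
open Literature.MathematicalPhysics.QuantumFieldTheory.Balaban1983to89
open scoped Matrix.Norms.L2Operator

/-! ## §1 The quaternion model is an isometry `(ℍ, ‖·‖) → (M₂(ℂ), ‖·‖_op)` compatible with `star` -/

/-- `quatMatrix` intertwines the quaternion conjugation and the conjugate transpose. [folklore] -/
theorem quatMatrix_star (q : ℍ) : quatMatrix (star q) = star (quatMatrix q) := by
  ext i j
  fin_cases i <;> fin_cases j <;> apply Complex.ext <;> simp [quatMatrix, Matrix.star_apply]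

/-- `dist1` of an element of `SU(2)` given by a unit quaternion is the quaternion distance to `1`. [folklore] -/
theorem dist1_eq_norm_sub_one_of_coe_eq (g : Matrix.specialUnitaryGroup (Fin 2) ℂ) (z : ℍ)
    (hg : (g : Matrix (Fin 2) (Fin 2) ℂ) = quatMatrix z) : GaugeGroup.dist1 g = ‖z - 1‖ := by
  have hdist : GaugeGroup.dist1 g = ‖(g : Matrix (Fin 2) (Fin 2) ℂ) - 1‖ := rfl
  rw [hdist, hg, T4QuatExpLog.norm_quatMatrix_sub_one]

/-! ## §2 The majorant for ordered products `Π (1 + xᵢ)` -/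

/-- `‖Σ_l x‖ ≤ |l|·η` when every `‖x‖ ≤ η`. [folklore] -/
theorem norm_list_sum_le_length_mul {A : Type*} [SeminormedAddCommGroup A] (l : List A) {η : ℝ}
    (h : ∀ x ∈ l, ‖x‖ ≤ η) : ‖l.sum‖ ≤ l.length * η := by
  induction l with
  | nil => simp
  | cons x l ih =>
    have hx : ‖x‖ ≤ η := h x (by simp)
    have hl := ih (fun y hy => h y (by simp [hy]))
    simp only [List.sum_cons, List.length_cons]
    push_cast
    calc ‖x + l.sum‖ ≤ ‖x‖ + ‖l.sum‖ := norm_add_le _ _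
      _ ≤ η + l.length * η := add_le_add hx hl
      _ = (l.length + 1) * η := by ring

/-- MAJORANT: in a normed ring, `‖Π(1 + xᵢ) − 1 − Σ xᵢ‖ ≤ (1 + η)^n − 1 − n η` when every `‖xᵢ‖ ≤ η` (the terms of degree `≥ 2`).
[folklore] -/
theorem norm_prod_one_add_sub_le {A : Type*} [NormedRing A] [NormOneClass A] (l : List A) {η : ℝ} (hη : 0 ≤ η)
    (h : ∀ x ∈ l, ‖x‖ ≤ η) :
    ‖(l.map (fun x => 1 + x)).prod - 1 - l.sum‖ ≤ (1 + η) ^ l.length - 1 - l.length * η := by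
  induction l with
  | nil => simp
  | cons x l ih =>
    have hx : ‖x‖ ≤ η := h x (by simp)
    have hl : ∀ y ∈ l, ‖y‖ ≤ η := fun y hy => h y (by simp [hy])
    have hR := ih hl
    set Pl := (l.map (fun x => 1 + x)).prod with hPl
    set R := Pl - 1 - l.sum with hRdef
    have hsum : ‖l.sum‖ ≤ l.length * η := norm_list_sum_le_length_mul l hl
    simp only [List.map_cons, List.prod_cons, List.sum_cons, List.length_cons]
    have hid : (1 + x) * Pl - 1 - (x + l.sum) = R + x * R + x * l.sum := by
      rw [hRdef]; noncomm_ring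
    rw [hid]
    have hn : (0 : ℝ) ≤ l.length := by positivity
    calc ‖R + x * R + x * l.sum‖ ≤ ‖R‖ + ‖x * R‖ + ‖x * l.sum‖ := norm_add₃_le
      _ ≤ ‖R‖ + ‖x‖ * ‖R‖ + ‖x‖ * ‖l.sum‖ := by gcongr <;> exact norm_mul_le _ _
      _ ≤ ((1 + η) ^ l.length - 1 - l.length * η) + η * ((1 + η) ^ l.length - 1 - l.length * η) + η * (l.length * η) := by
          gcongr
      _ = (1 + η) ^ (l.length + 1) - 1 - ↑(l.length + 1) * η := by push_cast; ring

/-! ## §3 The chord contraction of unit quaternions -/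

/-- For a unit quaternion `1 + b`: `‖1 + t•b‖² = 1 − t(1−t)‖b‖²`. [folklore] -/
theorem normSq_one_add_smul {b : ℍ} (hb : ‖1 + b‖ = 1) (t : ℝ) :
    ‖1 + t • b‖ ^ 2 = 1 - t * (1 - t) * ‖b‖ ^ 2 := by
  have h1 : normSq (1 + b) = 1 := by rw [Quaternion.normSq_eq_norm_mul_self, hb, mul_one]
  have e1 : normSq (1 + b) = 1 + 2 * b.re + normSq b := by
    rw [Quaternion.normSq_def', Quaternion.normSq_def']; simp; ring
  have e2 : normSq (1 + t • b) = 1 + 2 * t * b.re + t ^ 2 * normSq b := by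
    rw [Quaternion.normSq_def', Quaternion.normSq_def']; simp; ring
  have h2 : 2 * b.re = -normSq b := by linarith [e1, h1]
  rw [sq, sq, ← Quaternion.normSq_eq_norm_mul_self, ← Quaternion.normSq_eq_norm_mul_self, e2,
    show 2 * t * b.re = t * (2 * b.re) by ring, h2]
  ring

/-- For a unit quaternion `1 + b` with `‖b‖ ≤ η` and `t ∈ [0,1]`: `1 − η²/4 ≤ ‖1 + t•b‖ ≤ 1`. [folklore] -/
theorem norm_one_add_smul_bounds {b : ℍ} (hb : ‖1 + b‖ = 1) {η : ℝ} (hbη : ‖b‖ ≤ η) {t : ℝ} (ht0 : 0 ≤ t) (ht1 : t ≤ 1) :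
    1 - η ^ 2 / 4 ≤ ‖1 + t • b‖ ∧ ‖1 + t • b‖ ≤ 1 := by
  have hsq := normSq_one_add_smul hb t
  have hn : 0 ≤ ‖1 + t • b‖ := norm_nonneg _
  have hb0 : 0 ≤ ‖b‖ := norm_nonneg _
  have htt : t * (1 - t) ≤ 1 / 4 := by nlinarith [sq_nonneg (t - 1 / 2)]
  have htt0 : 0 ≤ t * (1 - t) := mul_nonneg ht0 (by linarith)
  have hη0 : 0 ≤ η := hb0.trans hbη
  constructor
  · -- `‖1+tb‖² ≥ 1 − η²/4 ≥ (1 − η²/4)²` when `η²/4 ≤ 1`; in general use `‖·‖ ≥ ‖·‖²` for `‖·‖ ≤ 1`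
    have hlow : 1 - η ^ 2 / 4 ≤ ‖1 + t • b‖ ^ 2 := by
      rw [hsq]; nlinarith [mul_le_mul htt (pow_le_pow_left₀ hb0 hbη 2) (sq_nonneg _) (by norm_num : (0:ℝ) ≤ 1/4)]
    have hle1 : ‖1 + t • b‖ ^ 2 ≤ 1 := by rw [hsq]; nlinarith [sq_nonneg ‖b‖]
    have hle1' : ‖1 + t • b‖ ≤ 1 := by nlinarith
    nlinarith
  · have hle1 : ‖1 + t • b‖ ^ 2 ≤ 1 := by rw [hsq]; nlinarith [sq_nonneg ‖b‖]
    nlinarith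

/-! ## §4 The chord contraction keeps a plaquette product within `16η²` of its value at `t = 1` -/
set_option maxHeartbeats 400000 in
/-- FOUR-FACTOR CHORD ESTIMATE: for unit quaternions `1 + bᵢ` with `‖bᵢ‖ ≤ η ≤ 1/4` and `t ∈ [0,1]`, the product of the normalised chords
`N(1 + t bᵢ)`, `N x = ‖x‖⁻¹ • x`, is within `‖Π(1 + bᵢ) − 1‖ + 16η²` of `1` (majorant for the degree `≥ 2` terms, twice, plus the
normalisation loss `1 − Π‖1 + t bᵢ‖ ≤ η²`). [folklore] -/
theorem norm_chordProd_sub_one_le (b₁ b₂ b₃ b₄ : ℍ) {η : ℝ} (hη : η ≤ 1 / 4)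
    (h₁ : ‖b₁‖ ≤ η) (h₂ : ‖b₂‖ ≤ η) (h₃ : ‖b₃‖ ≤ η) (h₄ : ‖b₄‖ ≤ η)
    (u₁ : ‖1 + b₁‖ = 1) (u₂ : ‖1 + b₂‖ = 1) (u₃ : ‖1 + b₃‖ = 1) (u₄ : ‖1 + b₄‖ = 1)
    {t : ℝ} (ht0 : 0 ≤ t) (ht1 : t ≤ 1) :
    ‖(‖1 + t • b₁‖⁻¹ • (1 + t • b₁)) * (‖1 + t • b₂‖⁻¹ • (1 + t • b₂)) * (‖1 + t • b₃‖⁻¹ • (1 + t • b₃)) *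
        (‖1 + t • b₄‖⁻¹ • (1 + t • b₄)) - 1‖ ≤
      ‖(1 + b₁) * (1 + b₂) * (1 + b₃) * (1 + b₄) - 1‖ + 16 * η ^ 2 := by
  have hη0 : 0 ≤ η := (norm_nonneg _).trans h₁
  -- the majorant, at `t` and at `1`
  set S : ℍ := b₁ + b₂ + b₃ + b₄ with hS
  set ρ : ℝ := (1 + η) ^ 4 - 1 - 4 * η with hρ
  have hρ' : ρ ≤ 15 / 2 * η ^ 2 := by
    have hη3 : η ^ 3 ≤ η ^ 2 / 4 := by nlinarith [sq_nonneg η]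
    have hη4 : η ^ 4 ≤ η ^ 2 / 16 := by nlinarith [sq_nonneg η, mul_nonneg hη0 (sq_nonneg η)]
    have : ρ = 6 * η ^ 2 + 4 * η ^ 3 + η ^ 4 := by rw [hρ]; ring
    rw [this]; linarith [sq_nonneg η]
  have hmaj : ∀ s : ℝ, 0 ≤ s → s ≤ 1 →
      ‖(1 + s • b₁) * (1 + s • b₂) * (1 + s • b₃) * (1 + s • b₄) - 1 - s • S‖ ≤ ρ := by
    intro s hs0 hs1
    have hl : ∀ x ∈ [s • b₁, s • b₂, s • b₃, s • b₄], ‖x‖ ≤ η := by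
      intro x hx
      simp only [List.mem_cons, List.mem_nil_iff, or_false] at hx
      have hsn : ∀ b : ℍ, ‖b‖ ≤ η → ‖s • b‖ ≤ η := fun b hb => by
        rw [norm_smul, Real.norm_eq_abs, abs_of_nonneg hs0]; nlinarith [norm_nonneg b]
      rcases hx with rfl | rfl | rfl | rfl
      · exact hsn _ h₁
      · exact hsn _ h₂
      · exact hsn _ h₃
      · exact hsn _ h₄
    have := norm_prod_one_add_sub_le [s • b₁, s • b₂, s • b₃, s • b₄] hη0 hl
    have hprod : (([s • b₁, s • b₂, s • b₃, s • b₄]).map (fun x => 1 + x)).prod =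
        (1 + s • b₁) * (1 + s • b₂) * (1 + s • b₃) * (1 + s • b₄) := by
      simp [mul_assoc]
    have hsum' : ([s • b₁, s • b₂, s • b₃, s • b₄]).sum = s • S := by
      simp [hS, smul_add, add_assoc]
    rw [hprod, hsum'] at this
    simpa [hρ] using this
  have hm1 := hmaj 1 zero_le_one le_rfl
  simp only [one_smul] at hm1
  have hmt := hmaj t ht0 ht1
  set Q₁ : ℍ := (1 + b₁) * (1 + b₂) * (1 + b₃) * (1 + b₄) with hQ₁
  set Qt : ℍ := (1 + t • b₁) * (1 + t • b₂) * (1 + t • b₃) * (1 + t • b₄) with hQt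
  -- `‖S‖ ≤ ‖Q₁ − 1‖ + ρ`, `‖Q_t − 1‖ ≤ ‖Q₁ − 1‖ + 2ρ`
  have hSle : ‖S‖ ≤ ‖Q₁ - 1‖ + ρ := by
    have : S = (Q₁ - 1) - (Q₁ - 1 - S) := by abel
    calc ‖S‖ = ‖(Q₁ - 1) - (Q₁ - 1 - S)‖ := by rw [← this]
      _ ≤ ‖Q₁ - 1‖ + ‖Q₁ - 1 - S‖ := norm_sub_le _ _
      _ ≤ ‖Q₁ - 1‖ + ρ := by linarith [hm1]
  have hQt1 : ‖Qt - 1‖ ≤ ‖Q₁ - 1‖ + 2 * ρ := by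
    have : Qt - 1 = (Qt - 1 - t • S) + t • S := by abel
    calc ‖Qt - 1‖ = ‖(Qt - 1 - t • S) + t • S‖ := by rw [← this]
      _ ≤ ‖Qt - 1 - t • S‖ + ‖t • S‖ := norm_add_le _ _
      _ ≤ ρ + ‖S‖ := by
          have : ‖t • S‖ ≤ ‖S‖ := by
            rw [norm_smul, Real.norm_eq_abs, abs_of_nonneg ht0]; nlinarith [norm_nonneg S]
          linarith [hmt]
      _ ≤ ‖Q₁ - 1‖ + 2 * ρ := by linarith
  -- normalisation: the product of the chords is `c⁻¹ • Q_t`, `c = Π ‖1 + t bᵢ‖ ∈ [1 − η², 1]`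
  obtain ⟨l₁, r₁⟩ := norm_one_add_smul_bounds u₁ h₁ ht0 ht1
  obtain ⟨l₂, r₂⟩ := norm_one_add_smul_bounds u₂ h₂ ht0 ht1
  obtain ⟨l₃, r₃⟩ := norm_one_add_smul_bounds u₃ h₃ ht0 ht1
  obtain ⟨l₄, r₄⟩ := norm_one_add_smul_bounds u₄ h₄ ht0 ht1
  have hq0 : 0 < 1 - η ^ 2 / 4 := by nlinarith
  set c : ℝ := ‖1 + t • b₁‖ * ‖1 + t • b₂‖ * ‖1 + t • b₃‖ * ‖1 + t • b₄‖ with hc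
  have hcpos : 0 < c := by rw [hc]; exact mul_pos (mul_pos (mul_pos (hq0.trans_le l₁) (hq0.trans_le l₂)) (hq0.trans_le l₃)) (hq0.trans_le l₄)
  have hc1 : c ≤ 1 := by
    rw [hc]
    exact mul_le_one₀ (mul_le_one₀ (mul_le_one₀ r₁ (norm_nonneg _) r₂) (norm_nonneg _) r₃) (norm_nonneg _) r₄
  have hclow : 1 - η ^ 2 ≤ c := by
    have hb4 : (1 - η ^ 2 / 4) ^ 4 ≤ c := by
      rw [hc, show (1 - η ^ 2 / 4) ^ 4 = (1 - η ^ 2 / 4) * (1 - η ^ 2 / 4) * (1 - η ^ 2 / 4) * (1 - η ^ 2 / 4) by ring]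
      exact mul_le_mul (mul_le_mul (mul_le_mul l₁ l₂ hq0.le (norm_nonneg _)) l₃ hq0.le (by positivity)) l₄ hq0.le
        (by positivity)
    have hbern : 1 - η ^ 2 ≤ (1 - η ^ 2 / 4) ^ 4 := by
      have := one_add_mul_le_pow (show (-2 : ℝ) ≤ -(η ^ 2 / 4) by nlinarith) 4
      linarith
    linarith
  have hPQ : (‖1 + t • b₁‖⁻¹ • (1 + t • b₁)) * (‖1 + t • b₂‖⁻¹ • (1 + t • b₂)) * (‖1 + t • b₃‖⁻¹ • (1 + t • b₃)) *
      (‖1 + t • b₄‖⁻¹ • (1 + t • b₄)) = c⁻¹ • Qt := by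
    rw [hQt, hc, smul_mul_smul_comm, smul_mul_smul_comm, smul_mul_smul_comm]
    congr 1
    field_simp
  have hQtnorm : ‖Qt‖ = c := by rw [hQt, hc, norm_mul, norm_mul, norm_mul]
  have hdiff : ‖c⁻¹ • Qt - Qt‖ ≤ η ^ 2 := by
    have : c⁻¹ • Qt - Qt = (c⁻¹ - 1) • Qt := by rw [sub_smul, one_smul]
    rw [this, norm_smul, hQtnorm, Real.norm_eq_abs, abs_of_nonneg (by rw [sub_nonneg]; exact one_le_inv_iff₀.mpr ⟨hcpos, hc1⟩),
      sub_mul, inv_mul_cancel₀ hcpos.ne', one_mul]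
    linarith
  rw [hPQ]
  calc ‖c⁻¹ • Qt - 1‖ = ‖(c⁻¹ • Qt - Qt) + (Qt - 1)‖ := by congr 1; abel
    _ ≤ ‖c⁻¹ • Qt - Qt‖ + ‖Qt - 1‖ := norm_add_le _ _
    _ ≤ η ^ 2 + (‖Q₁ - 1‖ + 2 * ρ) := add_le_add hdiff hQt1
    _ ≤ ‖Q₁ - 1‖ + 16 * η ^ 2 := by nlinarith [hρ']



/-! ## §A The chord contraction of a bondwise-small `SU(2)` configuration, plaquette by plaquette -/

section Contraction

open Quaternion
open Literature.MathematicalPhysics.QuantumLattice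
open Literature.MathematicalPhysics.QuantumFieldTheory.Balaban1983to89
open scoped Matrix.Norms.L2Operator

variable {P : Params} {j : ℕ}

/-- `‖star q‖ = ‖q‖` on `ℍ`. [folklore] -/
theorem norm_star_quat (q : ℍ) : ‖star q‖ = ‖q‖ := by
  have h : ‖star q‖ * ‖star q‖ = ‖q‖ * ‖q‖ := by
    rw [← Quaternion.normSq_eq_norm_mul_self, ← Quaternion.normSq_eq_norm_mul_self, Quaternion.normSq_star]
  nlinarith [norm_nonneg (star q), norm_nonneg q]

/-- The conjugate of a normalised chord is the normalised chord of the conjugate. [folklore] -/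
theorem star_normalize_one_add_smul (a : ℍ) (t : ℝ) :
    star (‖1 + t • a‖⁻¹ • (1 + t • a)) = ‖1 + t • star a‖⁻¹ • (1 + t • star a) := by
  have h1 : star (1 + t • a) = 1 + t • star a := by rw [star_add, star_one, Quaternion.star_smul]
  rw [Quaternion.star_smul, h1, ← h1, norm_star_quat]

/-- A normalised quaternion is within `1 − ‖y‖` of the quaternion (`‖y‖ ≤ 1`). [folklore] -/
theorem norm_normalize_sub_self {y : ℍ} (hy0 : 0 < ‖y‖) (hy1 : ‖y‖ ≤ 1) : ‖‖y‖⁻¹ • y - y‖ = 1 - ‖y‖ := by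
  have : ‖y‖⁻¹ • y - y = (‖y‖⁻¹ - 1) • y := by rw [sub_smul, one_smul]
  rw [this, norm_smul, Real.norm_eq_abs, abs_of_nonneg (by rw [sub_nonneg]; exact one_le_inv_iff₀.mpr ⟨hy0, hy1⟩), sub_mul,
    inv_mul_cancel₀ hy0.ne', one_mul]

/-- PLAQUETTE VARIABLES IN THE QUATERNION MODEL: for a configuration `e ↦ quatToSU2 (x e)` (`x e ≠ 0`), `dist1` of a plaquette variable is
the quaternion distance to `1` of the corresponding product of normalised quaternions (conjugates for the two returning bonds). [folklore] -/
theorem dist1_plaqHol_quatToSU2 (x : PBond P j → ℍ) (hx : ∀ e, x e ≠ 0) (p : Plaq P j) :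
    GaugeGroup.dist1 (GaugeField.plaqHol (fun e => quatToSU2 (x e)) p) =
      ‖(‖x ⟨p.src, p.μ⟩‖⁻¹ • x ⟨p.src, p.μ⟩) * (‖x ⟨p.src.shift p.μ, p.ν⟩‖⁻¹ • x ⟨p.src.shift p.μ, p.ν⟩) *
          star (‖x ⟨p.src.shift p.ν, p.μ⟩‖⁻¹ • x ⟨p.src.shift p.ν, p.μ⟩) * star (‖x ⟨p.src, p.ν⟩‖⁻¹ • x ⟨p.src, p.ν⟩) - 1‖ := by
  have hinv : ∀ g : Matrix.specialUnitaryGroup (Fin 2) ℂ,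
      ((g⁻¹ : Matrix.specialUnitaryGroup (Fin 2) ℂ) : Matrix (Fin 2) (Fin 2) ℂ) = star (g : Matrix (Fin 2) (Fin 2) ℂ) :=
    fun g => by rw [← Matrix.star_eq_inv]; rfl
  apply dist1_eq_norm_sub_one_of_coe_eq
  simp only [GaugeField.plaqHol, Submonoid.coe_mul, hinv, coe_quatToSU2 (hx _), quatMatrix_mul, quatMatrix_star]

/-- `dist1 (g' g⁻¹)` for two elements given by unit quaternions is the distance of the quaternions. [folklore] -/
theorem dist1_mul_inv_quatToSU2 {y y' : ℍ} (hy : ‖y‖ = 1) (hy' : ‖y'‖ = 1) :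
    GaugeGroup.dist1 (quatToSU2 y' * (quatToSU2 y)⁻¹) = ‖y' - y‖ := by
  have hy0 : y ≠ 0 := by intro h; rw [h, norm_zero] at hy; exact zero_ne_one hy
  have hy0' : y' ≠ 0 := by intro h; rw [h, norm_zero] at hy'; exact zero_ne_one hy'
  have hinv : ∀ g : Matrix.specialUnitaryGroup (Fin 2) ℂ,
      ((g⁻¹ : Matrix.specialUnitaryGroup (Fin 2) ℂ) : Matrix (Fin 2) (Fin 2) ℂ) = star (g : Matrix (Fin 2) (Fin 2) ℂ) :=
    fun g => by rw [← Matrix.star_eq_inv]; rfl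
  have hcoe : ((quatToSU2 y' * (quatToSU2 y)⁻¹ : Matrix.specialUnitaryGroup (Fin 2) ℂ) : Matrix (Fin 2) (Fin 2) ℂ) =
      quatMatrix (y' * star y) := by
    simp only [Submonoid.coe_mul, hinv, coe_quatToSU2_of_norm_eq_one hy, coe_quatToSU2_of_norm_eq_one hy',
      quatMatrix_mul, quatMatrix_star]
  rw [dist1_eq_norm_sub_one_of_coe_eq _ _ hcoe]
  have h1 : y * star y = 1 := by
    rw [Quaternion.self_mul_star, Quaternion.normSq_eq_norm_mul_self, hy]; simp
  have : y' * star y - 1 = (y' - y) * star y := by rw [sub_mul, h1]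
  rw [this, norm_mul, norm_star_quat, hy, mul_one]

/-- `quatToSU2` only sees the direction: `quatToSU2 y = quatToSU2 (‖y‖⁻¹ • y)`. [folklore] -/
theorem quatToSU2_eq_normalize {y : ℍ} (hy : ‖y‖ ≠ 0) : quatToSU2 y = quatToSU2 (‖y‖⁻¹ • y) := by
  have hy0 : y ≠ 0 := fun h => hy (by rw [h, norm_zero])
  have hyn : 0 < ‖y‖ := norm_pos_iff.mpr hy0
  have hunit : ‖‖y‖⁻¹ • y‖ = 1 := by rw [norm_smul, norm_inv, norm_norm, inv_mul_cancel₀ hyn.ne']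
  apply Subtype.ext
  rw [coe_quatToSU2 hy0, coe_quatToSU2_of_norm_eq_one hunit]

/-- ONE STEP OF THE DISCRETISED CONTRACTION: for a unit quaternion `1 + a` with `‖a‖ ≤ η` and `t, t' ∈ [0,1]`, the bondwise factor
`C_{t'} · C_t⁻¹` between the normalised chords is within `|t' − t|·η + η²/2` of `1`. [folklore] -/
theorem dist1_chordStep_le {a : ℍ} (ha1 : ‖1 + a‖ = 1) {η : ℝ} (hη : η ≤ 1 / 4) (haη : ‖a‖ ≤ η) {t t' : ℝ}
    (ht0 : 0 ≤ t) (ht1 : t ≤ 1) (ht0' : 0 ≤ t') (ht1' : t' ≤ 1) :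
    GaugeGroup.dist1 (quatToSU2 (1 + t' • a) * (quatToSU2 (1 + t • a))⁻¹) ≤ |t' - t| * η + η ^ 2 / 2 := by
  obtain ⟨l, r⟩ := norm_one_add_smul_bounds ha1 haη ht0 ht1
  obtain ⟨l', r'⟩ := norm_one_add_smul_bounds ha1 haη ht0' ht1'
  have hη0 : 0 ≤ η := (norm_nonneg _).trans haη
  have hq : η ^ 2 / 4 < 1 := by nlinarith
  have hpos : 0 < ‖1 + t • a‖ := lt_of_lt_of_le (by linarith) l
  have hpos' : 0 < ‖1 + t' • a‖ := lt_of_lt_of_le (by linarith) l'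
  set y : ℍ := 1 + t • a with hy
  set y' : ℍ := 1 + t' • a with hy'
  have hN : ‖‖y‖⁻¹ • y‖ = 1 := by rw [norm_smul, norm_inv, norm_norm, inv_mul_cancel₀ hpos.ne']
  have hN' : ‖‖y'‖⁻¹ • y'‖ = 1 := by rw [norm_smul, norm_inv, norm_norm, inv_mul_cancel₀ hpos'.ne']
  rw [quatToSU2_eq_normalize hpos.ne', quatToSU2_eq_normalize hpos'.ne', dist1_mul_inv_quatToSU2 hN hN']
  have hdiff : y' - y = (t' - t) • a := by rw [hy, hy', sub_smul]; abel
  calc ‖‖y'‖⁻¹ • y' - ‖y‖⁻¹ • y‖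
      = ‖(‖y'‖⁻¹ • y' - y') + (y' - y) + (y - ‖y‖⁻¹ • y)‖ := by congr 1; abel
    _ ≤ ‖‖y'‖⁻¹ • y' - y'‖ + ‖y' - y‖ + ‖y - ‖y‖⁻¹ • y‖ := norm_add₃_le
    _ = (1 - ‖y'‖) + ‖(t' - t) • a‖ + (1 - ‖y‖) := by
        rw [norm_normalize_sub_self hpos' r', hdiff, norm_sub_rev y, norm_normalize_sub_self hpos r]
    _ ≤ η ^ 2 / 4 + |t' - t| * η + η ^ 2 / 4 := by
        rw [norm_smul, Real.norm_eq_abs]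
        have : |t' - t| * ‖a‖ ≤ |t' - t| * η := mul_le_mul_of_nonneg_left haη (abs_nonneg _)
        linarith
    _ = |t' - t| * η + η ^ 2 / 2 := by ring

/-- THE CHORD CONTRACTION STAYS IN THE WINDOW: for a bondwise-small configuration `A` (`‖su2Quat (A e) − 1‖ ≤ η ≤ 1/4`), the configuration
`C_t e = quatToSU2 (1 + t (su2Quat (A e) − 1))`, `t ∈ [0,1]`, has every plaquette variable within `16η²` (in `dist1`) of `A`'s. [folklore] -/
theorem dist1_plaqHol_chord_le (A : GaugeField P j (Matrix.specialUnitaryGroup (Fin 2) ℂ)) {η : ℝ} (hη : η ≤ 1 / 4)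
    (hA : ∀ e, ‖su2Quat (A e) - 1‖ ≤ η) {t : ℝ} (ht0 : 0 ≤ t) (ht1 : t ≤ 1) (p : Plaq P j) :
    GaugeGroup.dist1 (GaugeField.plaqHol (fun e => quatToSU2 (1 + t • (su2Quat (A e) - 1))) p) ≤
      GaugeGroup.dist1 (GaugeField.plaqHol A p) + 16 * η ^ 2 := by
  have hunit : ∀ e, ‖1 + (su2Quat (A e) - 1)‖ = 1 := fun e => by rw [add_sub_cancel]; exact norm_su2Quat _
  have hη0 : 0 ≤ η := (norm_nonneg _).trans (hA ⟨p.src, p.μ⟩)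
  have hne : ∀ (s : ℝ), 0 ≤ s → s ≤ 1 → ∀ e, (1 : ℍ) + s • (su2Quat (A e) - 1) ≠ 0 := by
    intro s hs0 hs1 e h0
    have := (norm_one_add_smul_bounds (hunit e) (hA e) hs0 hs1).1
    rw [h0, norm_zero] at this
    nlinarith
  -- `A` itself is the chord configuration at `t = 1`
  have hA1 : A = fun e => quatToSU2 (1 + (1 : ℝ) • (su2Quat (A e) - 1)) := by
    funext e; rw [one_smul, add_sub_cancel, quatToSU2_su2Quat]
  rw [dist1_plaqHol_quatToSU2 _ (hne t ht0 ht1) p]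
  conv_rhs => rw [hA1, dist1_plaqHol_quatToSU2 _ (hne 1 zero_le_one le_rfl) p]
  simp only [star_normalize_one_add_smul, one_smul]
  have hN1 : ∀ e, ‖1 + (su2Quat (A e) - 1)‖⁻¹ • ((1 : ℍ) + (su2Quat (A e) - 1)) = 1 + (su2Quat (A e) - 1) := fun e => by
    rw [hunit, inv_one, one_smul]
  have hs' : ∀ q : ℍ, star (1 + (q - 1)) = 1 + star (q - 1) := fun q => by rw [star_add, star_one]
  simp only [hN1, hs']
  -- the four unit quaternions of the plaquette
  set b₁ : ℍ := su2Quat (A ⟨p.src, p.μ⟩) - 1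
  set b₂ : ℍ := su2Quat (A ⟨p.src.shift p.μ, p.ν⟩) - 1
  set b₃ : ℍ := star (su2Quat (A ⟨p.src.shift p.ν, p.μ⟩) - 1)
  set b₄ : ℍ := star (su2Quat (A ⟨p.src, p.ν⟩) - 1)
  have hs : ∀ q : ℍ, star (q - 1) = star q - 1 := fun q => by rw [star_sub, star_one]
  have u₃ : ‖1 + b₃‖ = 1 := by
    show ‖1 + star (su2Quat (A ⟨p.src.shift p.ν, p.μ⟩) - 1)‖ = 1
    rw [hs, add_sub_cancel, norm_star_quat, norm_su2Quat]
  have u₄ : ‖1 + b₄‖ = 1 := by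
    show ‖1 + star (su2Quat (A ⟨p.src, p.ν⟩) - 1)‖ = 1
    rw [hs, add_sub_cancel, norm_star_quat, norm_su2Quat]
  have n₃ : ‖b₃‖ ≤ η := by show ‖star _‖ ≤ η; rw [norm_star_quat]; exact hA _
  have n₄ : ‖b₄‖ ≤ η := by show ‖star _‖ ≤ η; rw [norm_star_quat]; exact hA _
  exact norm_chordProd_sub_one_le b₁ b₂ b₃ b₄ hη (hA _) (hA _) n₃ n₄ (hunit _) (hunit _) u₃ u₄ ht0 ht1

end Contraction

end Summit.QuantumFields.YangMills.Theorems.FlatRatioTermination
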